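import Summits.CriticalPhenomena.CardyFormulaZ2.Theses.CardySelfDualSegment
import Summits.CriticalPhenomena.CardyFormulaZ2.Theorems.CardyMagicRigidityLoopsToCrossingsStubComparisonGeometry
import Summits.CriticalPhenomena.CardyFormulaZ2.Theorems.CardyMagicRigidityLoopsToCrossingsStubCardyContinuity
import Literature.Probability.Percolation.CornerPercolation
import Literature.Probability.Percolation.CardyFormulaConformalInvariance
import Literature.Probability.Percolation.TriCrossingSandwich
import Literature.Probability.LatticeModels.TriangularLatticeProofs
import Literature.Probability.RandomPlanarGeometry.ImageUnivalent
import Literature.Probability.RandomPlanarGeometry.CollarGeometry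
import Literature.Barriers.CriticalPhenomena.EmbeddingModulusUniquenessProofs

/-!
# Crux `SmirnovBasePoint` (stmt-CriticalPhenomena-5474), line `Sketch`: stub `stub_shearDictionary`

The shear dictionary between the square frame and the triangular frame for the crude `M_0`
crossing probability `cornerCrossingProb 0 R' δ` of a conformal rectangle `R'`:

* (law) `cornerPercolation_zero`: `M_0 = (triSitePercolation half).map upTriangleConfig`, so the
  crude probability is the `triSitePercolation half`-measure of the `upTriangleConfig`-preimage of
  the crude event `embDomainCrossing squareLatticeEmbedding.z R'.carrier δ (R'.arc 0) (R'.arc 2)`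
  (`ShearDictionary.cornerCrossingProb_zero_eq`);
* (mesh) Beffara's shear `φ_ζ = moduliShear triZeta` maps the rescaled square lattice `δ √2 ℤ²`
  onto the rescaled triangular lattice: `φ_ζ (δ · z(y)) = triMeshPoint (√2 δ) y`
  (`ShearDictionary.moduliShear_squareMesh`), and `φ_ζ` is injective;
* (distances) `|w| / √2 ≤ |φ_ζ w| ≤ √(3/2) |w|` (`|φ_ζ (x + iy)|² = x² + xy + y²`), whence
  `infDist (φ_ζ p) (φ_ζ '' A) ≤ √(3/2) · infDist p A` and `infDist p A ≤ √2 · infDist (φ_ζ p) (φ_ζ '' A)`.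

Consequently the crude event sits between the two `𝕋`-frame crude events of `φ_ζ R'` at `𝕋`-mesh
`√2 δ` with slacks `√2 δ` and `2 √2 δ` (monotonicity of `openCrossing` in the endpoint sets,
`openCrossing_mono`). Sources: Bollobás–Riordan 2010 §2 (the model `M_0` as site percolation on
the triangular lattice of corners), Beffara 2008 §1.1 (the shear `φ_β`).
-/

noncomputable section

namespace Summit.CriticalPhenomena.CardyFormulaZ2.Cruxes.SmirnovBasePoint.ShearedSandwich

open Literature.Probability.RandomPlanarGeometry hiding cardyFunction
open Literature.Probability.Percolation hiding cardyFunction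
open Literature.Probability.LatticeModels
open Literature.Barriers.CriticalPhenomena
open Summit.CriticalPhenomena.CardyFormulaZ2.Cruxes.LoopsToCrossings.OracleSandwich
open Filter Topology Set MeasureTheory Metric

namespace ShearDictionary

/-! ## The shear `φ_ζ`: linearity, injectivity, norms, distances -/

/-- `φ_β (a - b) = φ_β a - φ_β b` (`φ_β` is `ℝ`-linear). [cite: Beffara2008Universal, §1.1] -/
theorem moduliShear_sub (β a b : ℂ) :
    moduliShear β (a - b) = moduliShear β a - moduliShear β b := by
  simp only [moduliShear, Complex.sub_re, Complex.sub_im, Complex.ofReal_sub]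
  ring

/-- `dist (φ_β a) (φ_β b) = |φ_β (a - b)|`. [cite: Beffara2008Universal, §1.1] -/
theorem dist_moduliShear_eq (β a b : ℂ) :
    dist (moduliShear β a) (moduliShear β b) = ‖moduliShear β (a - b)‖ := by
  rw [dist_eq_norm, moduliShear_sub]

/-- `φ_ζ` is injective (it is a homeomorphism of the plane, `shearHomeomorph`; `Im ζ ≠ 0` is the
tree's `triZeta_im_ne_zero`). [cite: Beffara2008Universal, §1.1] -/
theorem moduliShear_triZeta_injective : Function.Injective (moduliShear triZeta) :=
  (shearHomeomorph triZeta Literature.Probability.Percolation.triZeta_im_ne_zero).injective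

/-- `|φ_ζ (x + iy)|² = x² + xy + y²`. [folklore] -/
theorem sq_norm_moduliShear_triZeta (w : ℂ) :
    ‖moduliShear triZeta w‖ ^ 2 = w.re ^ 2 + w.re * w.im + w.im ^ 2 := by
  rw [Complex.sq_norm, Complex.normSq_apply]
  simp only [moduliShear, Complex.add_re, Complex.add_im, Complex.mul_re, Complex.mul_im,
    Complex.ofReal_re, Complex.ofReal_im, triZeta_re, triZeta_im, mul_zero, sub_zero, zero_add]
  have h3 : Real.sqrt 3 * Real.sqrt 3 = 3 := Real.mul_self_sqrt (by norm_num)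
  nlinarith [h3]

/-- `|φ_ζ w| ≤ √(3/2) |w|` (since `x² + xy + y² ≤ (3/2)(x² + y²)`). [folklore] -/
theorem norm_moduliShear_triZeta_le (w : ℂ) :
    ‖moduliShear triZeta w‖ ≤ Real.sqrt (3 / 2) * ‖w‖ := by
  have h1 : ‖moduliShear triZeta w‖ ^ 2 ≤ (Real.sqrt (3 / 2) * ‖w‖) ^ 2 := by
    rw [mul_pow, Real.sq_sqrt (by norm_num), sq_norm_moduliShear_triZeta, Complex.sq_norm,
      Complex.normSq_apply]
    nlinarith [sq_nonneg (w.re - w.im)]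
  exact (sq_le_sq₀ (norm_nonneg _) (by positivity)).1 h1

/-- `|w| ≤ √2 |φ_ζ w|` (since `(x² + y²)/2 ≤ x² + xy + y²`). [folklore] -/
theorem norm_le_sqrt_two_mul_norm_moduliShear_triZeta (w : ℂ) :
    ‖w‖ ≤ Real.sqrt 2 * ‖moduliShear triZeta w‖ := by
  have h1 : ‖w‖ ^ 2 ≤ (Real.sqrt 2 * ‖moduliShear triZeta w‖) ^ 2 := by
    rw [mul_pow, Real.sq_sqrt (by norm_num), sq_norm_moduliShear_triZeta, Complex.sq_norm,
      Complex.normSq_apply]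
    nlinarith [sq_nonneg (w.re + w.im)]
  exact (sq_le_sq₀ (norm_nonneg _) (by positivity)).1 h1

/-- `dist (φ_ζ a) (φ_ζ b) ≤ √(3/2) · dist a b`. [folklore] -/
theorem dist_moduliShear_triZeta_le (a b : ℂ) :
    dist (moduliShear triZeta a) (moduliShear triZeta b) ≤ Real.sqrt (3 / 2) * dist a b := by
  rw [dist_moduliShear_eq, dist_eq_norm]
  exact norm_moduliShear_triZeta_le _

/-- `dist a b ≤ √2 · dist (φ_ζ a) (φ_ζ b)`. [folklore] -/
theorem dist_le_sqrt_two_mul_dist_moduliShear_triZeta (a b : ℂ) :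
    dist a b ≤ Real.sqrt 2 * dist (moduliShear triZeta a) (moduliShear triZeta b) := by
  rw [dist_moduliShear_eq, dist_eq_norm]
  exact norm_le_sqrt_two_mul_norm_moduliShear_triZeta _

/-- `infDist (φ_ζ p) (φ_ζ '' A) ≤ √(3/2) · infDist p A`. [folklore] -/
theorem infDist_moduliShear_image_le (p : ℂ) (A : Set ℂ) :
    infDist (moduliShear triZeta p) (moduliShear triZeta '' A) ≤ Real.sqrt (3 / 2) * infDist p A := by
  rcases A.eq_empty_or_nonempty with rfl | hA
  · simp
  have hc : (0 : ℝ) < Real.sqrt (3 / 2) := Real.sqrt_pos.2 (by norm_num)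
  rw [← div_le_iff₀' hc]
  refine (le_infDist hA).2 fun a ha => ?_
  rw [div_le_iff₀' hc]
  exact (infDist_le_dist_of_mem (mem_image_of_mem _ ha)).trans (dist_moduliShear_triZeta_le p a)

/-- `infDist p A ≤ √2 · infDist (φ_ζ p) (φ_ζ '' A)`. [folklore] -/
theorem infDist_le_sqrt_two_mul_infDist_moduliShear_image (p : ℂ) (A : Set ℂ) :
    infDist p A ≤ Real.sqrt 2 * infDist (moduliShear triZeta p) (moduliShear triZeta '' A) := by
  rcases A.eq_empty_or_nonempty with rfl | hA
  · simp
  have hc : (0 : ℝ) < Real.sqrt 2 := Real.sqrt_pos.2 two_pos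
  rw [← div_le_iff₀' hc]
  refine (le_infDist (hA.image _)).2 ?_
  rintro _ ⟨a, ha, rfl⟩
  rw [div_le_iff₀' hc]
  exact (infDist_le_dist_of_mem ha).trans (dist_le_sqrt_two_mul_dist_moduliShear_triZeta p a)

/-! ## The mesh dictionary `φ_ζ (δ · z(y)) = triMeshPoint (√2 δ) y` -/

/-- The shear `φ_ζ` maps the vertex `δ z(y) = δ √2 (y₀ + i y₁)` of the rescaled square lattice to
the vertex `√2 δ (y₀ + y₁ ζ)` of the rescaled triangular lattice. [cite: Beffara2008Universal, §1.1] -/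
theorem moduliShear_squareMesh (δ : ℝ) (y : Site 2) :
    moduliShear triZeta ((δ : ℂ) * squareLatticeEmbedding.z y) = triMeshPoint (Real.sqrt 2 * δ) y := by
  rw [squareLatticeEmbedding_z, triMeshPoint, triEmbed]
  apply Complex.ext
  · simp only [moduliShear, Complex.add_re, Complex.mul_re, Complex.mul_im, Complex.ofReal_re,
      Complex.ofReal_im, Site.toComplex_re, Site.toComplex_im, Complex.intCast_re,
      Complex.intCast_im, triZeta_re, triZeta_im, Complex.ofReal_mul]
    ring
  · simp only [moduliShear, Complex.add_im, Complex.mul_re, Complex.mul_im, Complex.ofReal_re,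
      Complex.ofReal_im, Site.toComplex_re, Site.toComplex_im, Complex.intCast_re,
      Complex.intCast_im, triZeta_re, triZeta_im, Complex.ofReal_mul]
    ring

/-- The site set of the crude event in the two frames agree:
`triMeshPoint (√2 δ) y ∈ φ_ζ Ω ↔ δ z(y) ∈ Ω` (injectivity of `φ_ζ`). [folklore] -/
theorem setOf_triMeshPoint_mem_image (δ : ℝ) (Ω : Set ℂ) :
    {y : Site 2 | triMeshPoint (Real.sqrt 2 * δ) y ∈ moduliShear triZeta '' Ω} =
      {y : Site 2 | (δ : ℂ) * squareLatticeEmbedding.z y ∈ Ω} := by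
  ext y
  simp only [mem_setOf_eq, ← moduliShear_squareMesh, moduliShear_triZeta_injective.mem_set_image]

/-- Square slack from triangular slack: if `triMeshPoint (√2 δ) u` is within `√2 δ` of `φ_ζ A`,
then `δ z(u)` is within `√2 · √2 δ = 2 δ` of `A`. [folklore] -/
theorem infDist_le_two_mul_of_tri {δ : ℝ} (A : Set ℂ) {u : Site 2}
    (hu : infDist (triMeshPoint (Real.sqrt 2 * δ) u) (moduliShear triZeta '' A) ≤ Real.sqrt 2 * δ) :
    infDist ((δ : ℂ) * squareLatticeEmbedding.z u) A ≤ 2 * δ := by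
  have h2 : Real.sqrt 2 * (Real.sqrt 2 * δ) = 2 * δ := by
    rw [← mul_assoc, Real.mul_self_sqrt zero_le_two]
  calc infDist ((δ : ℂ) * squareLatticeEmbedding.z u) A
      ≤ Real.sqrt 2 * infDist (moduliShear triZeta ((δ : ℂ) * squareLatticeEmbedding.z u))
          (moduliShear triZeta '' A) := infDist_le_sqrt_two_mul_infDist_moduliShear_image _ _
    _ = Real.sqrt 2 * infDist (triMeshPoint (Real.sqrt 2 * δ) u) (moduliShear triZeta '' A) := by
          rw [moduliShear_squareMesh]
    _ ≤ Real.sqrt 2 * (Real.sqrt 2 * δ) := by gcongr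
    _ = 2 * δ := h2

/-- Triangular slack from square slack: if `δ z(u)` is within `2 δ` of `A` (`0 ≤ δ`), then
`triMeshPoint (√2 δ) u` is within `√(3/2) · 2 δ ≤ 2 √2 δ` of `φ_ζ A`. [folklore] -/
theorem infDist_tri_le_of_square {δ : ℝ} (hδ : 0 ≤ δ) (A : Set ℂ) {u : Site 2}
    (hu : infDist ((δ : ℂ) * squareLatticeEmbedding.z u) A ≤ 2 * δ) :
    infDist (triMeshPoint (Real.sqrt 2 * δ) u) (moduliShear triZeta '' A) ≤ 2 * (Real.sqrt 2 * δ) := by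
  have hs : Real.sqrt (3 / 2) ≤ Real.sqrt 2 := Real.sqrt_le_sqrt (by norm_num)
  calc infDist (triMeshPoint (Real.sqrt 2 * δ) u) (moduliShear triZeta '' A)
      = infDist (moduliShear triZeta ((δ : ℂ) * squareLatticeEmbedding.z u))
          (moduliShear triZeta '' A) := by rw [moduliShear_squareMesh]
    _ ≤ Real.sqrt (3 / 2) * infDist ((δ : ℂ) * squareLatticeEmbedding.z u) A :=
          infDist_moduliShear_image_le _ _
    _ ≤ Real.sqrt (3 / 2) * (2 * δ) := by gcongr
    _ ≤ Real.sqrt 2 * (2 * δ) := by gcongr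
    _ = 2 * (Real.sqrt 2 * δ) := by ring

/-! ## The law dictionary -/

/-- **`M_0` drawn on `√2 ℤ²` is fair site percolation on `𝕋` read through `upTriangleConfig`**:
`P_0(R', δ)` is the `triSitePercolation half`-probability of the `upTriangleConfig`-preimage of the
crude event, an `openCrossing` event with site set `{y | δ z(y) ∈ Ω'}` and endpoint sets the sites
within `2δ` of the arcs `0`, `2`. [cite: BollobasRiordan2010, §2 Thm. 2.2 (site percolation on a triangulation, p = 1/2)] -/
theorem cornerCrossingProb_zero_eq (R' : ConformalRectangle) (δ : ℝ) :
    cornerCrossingProb 0 R' δ = (triSitePercolation half).real (upTriangleConfig ⁻¹' openCrossing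
      {y : Site 2 | (δ : ℂ) * squareLatticeEmbedding.z y ∈ R'.carrier}
      {u : Site 2 | infDist ((δ : ℂ) * squareLatticeEmbedding.z u) (R'.arc 0) ≤ 2 * δ}
      {v : Site 2 | infDist ((δ : ℂ) * squareLatticeEmbedding.z v) (R'.arc 2) ≤ 2 * δ}) := by
  rw [cornerCrossingProb_eq, cornerPercolation_zero,
    map_measureReal_apply measurable_upTriangleConfig (measurableSet_embDomainCrossing _ _ _ _ _)]
  rfl

end ShearDictionary

open ShearDictionary in
/-- **Stub A (shear dictionary).** The square-frame crude `M_0` crossing probability of `R'` at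
mesh `δ` lies between the `𝕋`-frame crude probabilities of `φ_ζ R'` at `𝕋`-mesh `√2 δ` with
slacks `√2 δ` and `2 √2 δ`: `cornerPercolation_zero` (law), `φ_ζ (δ z(v)) = triMeshPoint (√2 δ) v`
(mesh), and `|w|/√2 ≤ |φ_ζ w| ≤ √(3/2) |w|` (distances); both inequalities are monotonicity of the
`openCrossing` event in its endpoint sets. [cite: BollobasRiordan2010, §2 Thm. 2.2 (site percolation on a triangulation, p = 1/2)] -/
theorem stub_shearDictionary : ∀ (R' : ConformalRectangle) (δ : ℝ), 0 < δ →
    (triSitePercolation half).real (upTriangleConfig ⁻¹' openCrossing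
        {y : Site 2 | triMeshPoint (Real.sqrt 2 * δ) y ∈ moduliShear triZeta '' R'.carrier}
        {u : Site 2 | infDist (triMeshPoint (Real.sqrt 2 * δ) u) (moduliShear triZeta '' R'.arc 0) ≤ Real.sqrt 2 * δ}
        {v : Site 2 | infDist (triMeshPoint (Real.sqrt 2 * δ) v) (moduliShear triZeta '' R'.arc 2) ≤ Real.sqrt 2 * δ})
      ≤ cornerCrossingProb 0 R' δ ∧
    cornerCrossingProb 0 R' δ ≤ (triSitePercolation half).real (upTriangleConfig ⁻¹' openCrossing
        {y : Site 2 | triMeshPoint (Real.sqrt 2 * δ) y ∈ moduliShear triZeta '' R'.carrier}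
        {u : Site 2 | infDist (triMeshPoint (Real.sqrt 2 * δ) u) (moduliShear triZeta '' R'.arc 0) ≤ 2 * (Real.sqrt 2 * δ)}
        {v : Site 2 | infDist (triMeshPoint (Real.sqrt 2 * δ) v) (moduliShear triZeta '' R'.arc 2) ≤ 2 * (Real.sqrt 2 * δ)}) := by
  intro R' δ hδ
  rw [cornerCrossingProb_zero_eq, setOf_triMeshPoint_mem_image]
  refine ⟨measureReal_mono (preimage_mono (openCrossing_mono le_rfl ?_ ?_)) (measure_ne_top _ _),
    measureReal_mono (preimage_mono (openCrossing_mono le_rfl ?_ ?_)) (measure_ne_top _ _)⟩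
  · exact fun u hu => infDist_le_two_mul_of_tri (R'.arc 0) hu
  · exact fun v hv => infDist_le_two_mul_of_tri (R'.arc 2) hv
  · exact fun u hu => infDist_tri_le_of_square hδ.le (R'.arc 0) hu
  · exact fun v hv => infDist_tri_le_of_square hδ.le (R'.arc 2) hv

end Summit.CriticalPhenomena.CardyFormulaZ2.Cruxes.SmirnovBasePoint.ShearedSandwich
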